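import Mathlib
import Literature.NumberTheory.Automorphic.HyperbolicLaplaceSpectrum
import Literature.NumberTheory.Automorphic.InvariantOperatorEigenfunctions

/-!
# The zero-th Fourier mode of a Maass form: Euler equation and square-integrability
(Iwaniec, *Spectral Methods of Automorphic Forms*, GSM 53, §1.7 (1.23), §3.1 (3.2)–(3.5), Thm 3.2)

Analytic infrastructure for the `L²` theory of Maass forms of the modular group used by the
decomposition of `Literature.NumberTheory.Automorphic.Iwaniec2002_modular_smallSpectrum`
(`HyperbolicLaplaceSpectrum.lean`), all PROVED:

* **strip calculus** (§ StripCalculus): derivatives of `x ↦ G(x+iy)`, `y ↦ G(x+iy)` for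
  `G : ℂ → ℂ` differentiable over `ℝ`, and differentiation under `∫₀¹ … dx` in `y` for `G` of class
  `C¹` on the open upper half-plane (dominated differentiation on a compact box);
* **the Euler equation** (§ EulerODE): a twice differentiable `a : (0,∞) → ℂ` with
  `y² a'' = -s(1-s) a`, `s ≠ 1/2`, is `A y^s + B y^{1-s}` (Iwaniec (1.23); two explicit first
  integrals, no ODE-uniqueness theory);
* **the zero-th mode** (§ ZeroMode): for `F : ℂ → ℂ` of class `C²` on `{Im > 0}`, `1`-periodic, with
  `(Im z)² ΔF + l F = 0` (`Δ` = Mathlib's Euclidean `Laplacian.laplacian`, so `(Im z)² Δ` is the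
  hyperbolic Laplacian (1.19)), the mode `a(y) = ∫₀¹ F(x+iy) dx` satisfies `y² a'' = -l a`, hence
  `a(y) = A y^s + B y^{1-s}` for `l = s(1-s)` — the zero-th term of the Fourier expansion (3.4)–(3.5);
* **the cuspidal strip** (§ Strip): transfer of integrals for Mathlib's hyperbolic `volume` on `ℍ`
  (`dx dy / y²`) to Lebesgue measure on `ℂ ≅ ℝ × ℝ`, and: `|v|²` integrable on `𝒟` implies
  `∫_{y ≥ 1} y⁻² ∫_{|x| ≤ 1/2} |v(x+iy)|² dx dy < ∞` (the strip `UpperHalfPlane.verticalStrip (1/2) 1`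
  lies in `𝒟`; Tonelli);
* **the tail** (§ Tail): Jensen `‖∫_a^{a+1} f‖² ≤ ∫_a^{a+1} ‖f‖²`, and
  `∫_{y ≥ 1} y⁻² |A y^s + B y^{1-s}|² dy < ∞` with `s > 1/2` forces `A = 0` (`y^{2s-2}` is not
  integrable at `∞`);
* **Theorem 3.2, zero-th term, for `SL₂(ℤ)`** (§ ZeroTerm): an `SL₂(ℤ)`-automorphic `C²` solution
  of `(Δ + s(1-s)) v = 0`, `s > 1/2`, square-integrable on `𝒟`, has zero-th Fourier coefficient
  `∫₀¹ v(x+iy) dx = B y^{1-s}` ("the zero-th term … takes the form `f̂_𝔞(0) y^{1-s}`", p. 42).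

Design: everything is phrased for the extension `F = v ∘ ofComplex : ℂ → ℂ` and points
`(x : ℂ) + (y : ℂ) * I`, matching `IsC2`/`hypLaplacian` of `HyperbolicLaplaceSpectrum.lean`; no
Bessel/Whittaker functions are needed for the zero-th mode. Not here: the non-zero modes (Whittaker
functions), the energy identity, Eisenstein series.

## References

* [Iwaniec2002] H. Iwaniec, *Spectral Methods of Automorphic Forms*, 2nd ed., GSM 53, AMS 2002
  (held copy `book:iwaniec2002-spectral-methods-automorphic-forms`, PDF pages): (1.19), (1.22)–(1.23)
  pp. 16–17; (3.2)–(3.5), Thm 3.1, Thm 3.2 and its proof pp. 40–42.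
-/

noncomputable section

namespace Literature.NumberTheory.Automorphic

open Filter _root_.MeasureTheory Real intervalIntegral Set
open scoped _root_.Topology Interval

/-! ### Strip calculus: derivatives of `x ↦ G(x+iy)` and `y ↦ G(x+iy)`, differentiation under `∫₀¹` -/

section StripCalculus

/-- `t ↦ t + iy` has derivative `1`. [folklore] -/
theorem hasDerivAt_horizontal (x y : ℝ) :
    HasDerivAt (fun t : ℝ => (t : ℂ) + (y : ℂ) * Complex.I) 1 x := by
  have h := ((hasDerivAt_id x).ofReal_comp).add_const ((y : ℂ) * Complex.I)
  simpa using h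

/-- `t ↦ x + it` has derivative `i`. [folklore] -/
theorem hasDerivAt_vertical (x y : ℝ) :
    HasDerivAt (fun t : ℝ => (x : ℂ) + (t : ℂ) * Complex.I) Complex.I y := by
  have h := (((hasDerivAt_id y).ofReal_comp).mul_const Complex.I).const_add (x : ℂ)
  simpa using h

variable {G : ℂ → ℂ}

/-- `d/dx G(x + iy) = G'(x+iy) 1`.
[folklore] -/
theorem hasDerivAt_comp_horizontal {x y : ℝ}
    (hG : DifferentiableAt ℝ G ((x : ℂ) + (y : ℂ) * Complex.I)) :
    HasDerivAt (fun t : ℝ => G ((t : ℂ) + (y : ℂ) * Complex.I))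
      (fderiv ℝ G ((x : ℂ) + (y : ℂ) * Complex.I) 1) x := by
  have h := hG.hasFDerivAt.comp_hasDerivAt x (hasDerivAt_horizontal x y)
  simpa [Function.comp_def] using h

/-- `d/dy G(x + iy) = G'(x+iy) I`.
[folklore] -/
theorem hasDerivAt_comp_vertical {x y : ℝ}
    (hG : DifferentiableAt ℝ G ((x : ℂ) + (y : ℂ) * Complex.I)) :
    HasDerivAt (fun t : ℝ => G ((x : ℂ) + (t : ℂ) * Complex.I))
      (fderiv ℝ G ((x : ℂ) + (y : ℂ) * Complex.I) Complex.I) y := by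
  have h := hG.hasFDerivAt.comp_hasDerivAt y (hasDerivAt_vertical x y)
  simpa [Function.comp_def] using h

/-- The derivative of `w ↦ G'(w) u` is `h ↦ G''(w) h u`.
[folklore] -/
theorem hasFDerivAt_fderiv_apply {w : ℂ} (u : ℂ)
    (hG : DifferentiableAt ℝ (fderiv ℝ G) w) :
    HasFDerivAt (fun w' => fderiv ℝ G w' u) ((fderiv ℝ (fderiv ℝ G) w).flip u) w := by
  have h := hG.hasFDerivAt.clm_apply (hasFDerivAt_const u w)
  simpa using h

/-- `∂_h (G'(·) u) = G''(·) h u`. [folklore] -/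
theorem fderiv_fderiv_apply {w : ℂ} (u h : ℂ) (hG : DifferentiableAt ℝ (fderiv ℝ G) w) :
    fderiv ℝ (fun w' => fderiv ℝ G w' u) w h = fderiv ℝ (fderiv ℝ G) w h u := by
  rw [(hasFDerivAt_fderiv_apply u hG).fderiv]
  rfl

/-- Continuity in `x` of `G(x+iy)` for `y > 0` when `G` is continuous on the upper half-plane.
[folklore] -/
theorem continuous_comp_horizontal (hG : ContinuousOn G {z : ℂ | 0 < z.im}) {y : ℝ} (hy : 0 < y) :
    Continuous fun t : ℝ => G ((t : ℂ) + (y : ℂ) * Complex.I) := by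
  refine hG.comp_continuous (by fun_prop) fun t => ?_
  simpa using hy

/-- **Differentiation under `∫₀¹` in the vertical direction.** For `G` of class `C¹` on the open
upper half-plane and `y > 0`,
`d/dy ∫₀¹ G(x+iy) dx = ∫₀¹ G'(x+iy) I dx`.
[folklore] -/
theorem hasDerivAt_integral_vertical (hG : ContDiffOn ℝ 1 G {z : ℂ | 0 < z.im}) {y : ℝ}
    (hy : 0 < y) :
    HasDerivAt (fun t : ℝ => ∫ x in (0 : ℝ)..1, G ((x : ℂ) + (t : ℂ) * Complex.I))
      (∫ x in (0 : ℝ)..1, fderiv ℝ G ((x : ℂ) + (y : ℂ) * Complex.I) Complex.I) y := by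
  set U : Set ℂ := {z : ℂ | 0 < z.im} with hU
  have hUo : IsOpen U := UpperHalfPlane.isOpen_upperHalfPlaneSet
  have hcont : ContinuousOn G U := hG.continuousOn
  have hcontd : ContinuousOn (fderiv ℝ G) U := hG.continuousOn_fderiv_of_isOpen hUo le_rfl
  have hdiff : DifferentiableOn ℝ G U := hG.differentiableOn one_ne_zero
  -- the parameter neighbourhood and the compact box
  set S : Set ℝ := Icc (y / 2) (2 * y) with hS
  have hSnhds : S ∈ 𝓝 y := Icc_mem_nhds (by linarith) (by linarith)
  set Φ : ℝ × ℝ → ℂ := fun p => (p.1 : ℂ) + (p.2 : ℂ) * Complex.I with hΦ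
  have hΦc : Continuous Φ := by simp only [hΦ]; fun_prop
  set R : Set (ℝ × ℝ) := Icc (0 : ℝ) 1 ×ˢ S with hR
  have hRc : IsCompact R := isCompact_Icc.prod isCompact_Icc
  have hRU : ∀ p ∈ R, Φ p ∈ U := by
    rintro ⟨t, s⟩ ⟨-, hs⟩
    simp only [hΦ, hU, mem_setOf_eq]
    have : y / 2 ≤ s := hs.1
    simpa using (by linarith : (0 : ℝ) < s)
  have hψ : ContinuousOn (fun p : ℝ × ℝ => fderiv ℝ G (Φ p) Complex.I) R :=
    ((hcontd.comp hΦc.continuousOn hRU).clm_apply continuousOn_const)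
  obtain ⟨M, hM⟩ := hRc.exists_bound_of_continuousOn hψ
  have key := intervalIntegral.hasDerivAt_integral_of_dominated_loc_of_deriv_le
    (μ := volume) (a := (0 : ℝ)) (b := 1) (𝕜 := ℝ)
    (F := fun (t : ℝ) (x : ℝ) => G ((x : ℂ) + (t : ℂ) * Complex.I))
    (F' := fun (t : ℝ) (x : ℝ) => fderiv ℝ G ((x : ℂ) + (t : ℂ) * Complex.I) Complex.I)
    (x₀ := y) (bound := fun _ => M) hSnhds ?_ ?_ ?_ ?_ ?_ ?_
  · exact key.2
  · -- measurability near `y`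
    filter_upwards [Ioi_mem_nhds hy] with t ht
    exact (continuous_comp_horizontal hcont ht).aestronglyMeasurable
  · exact (continuous_comp_horizontal hcont hy).intervalIntegrable _ _
  · have hc : Continuous fun x : ℝ => fderiv ℝ G ((x : ℂ) + (y : ℂ) * Complex.I) Complex.I :=
      ((hcontd.comp_continuous (by fun_prop) fun t => by simpa [hU] using hy)).clm_apply
        continuous_const
    exact hc.aestronglyMeasurable
  · refine Eventually.of_forall fun x hx t ht => hM (x, t) ⟨?_, ht⟩
    rw [uIoc_of_le zero_le_one] at hx
    exact ⟨hx.1.le, hx.2⟩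
  · exact intervalIntegrable_const
  · refine Eventually.of_forall fun x _ t ht => ?_
    have htpos : 0 < t := by have : y / 2 ≤ t := ht.1; linarith
    apply hasDerivAt_comp_vertical
    exact hdiff.differentiableAt (hUo.mem_nhds (by simpa [hU] using htpos))

end StripCalculus

/-! ### The Euler equation `y² a'' = -s(1-s) a` on `(0, ∞)` -/

section EulerODE

/-- `y ↦ (y ^ a : ℝ)` cast to `ℂ` has derivative `a y^{a-1}` at `y > 0`.
[folklore] -/
theorem hasDerivAt_ofReal_rpow {y : ℝ} (hy : 0 < y) (a : ℝ) :
    HasDerivAt (fun t : ℝ => ((t ^ a : ℝ) : ℂ)) (((a * y ^ (a - 1) : ℝ) : ℂ)) y :=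
  (Real.hasDerivAt_rpow_const (Or.inl hy.ne')).ofReal_comp

/-- A function on `(0,∞)` with zero derivative is constant there.
[folklore] -/
theorem exists_const_of_hasDerivAt_zero_Ioi {f : ℝ → ℂ}
    (hf : ∀ y : ℝ, 0 < y → HasDerivAt f 0 y) : ∃ K : ℂ, ∀ y : ℝ, 0 < y → f y = K := by
  obtain ⟨K, hK⟩ := isOpen_Ioi.exists_is_const_of_deriv_eq_zero (convex_Ioi (0 : ℝ)).isPreconnected
    (fun y hy => (hf y hy).differentiableAt.differentiableWithinAt)
    (fun y hy => (hf y hy).deriv)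
  exact ⟨K, fun y hy => hK y hy⟩

/-- **Solutions of the Euler equation.** If `a : (0,∞) → ℂ` is twice differentiable with
`a' = p`, `p' = q` and `y² q = -s(1-s) a`, `s ≠ 1/2`, then `a(y) = A y^s + B y^{1-s}`
(Iwaniec (1.23): the two solutions `y^s, y^{1-s}`).
[cite: Iwaniec2002, (1.23), PDF p. 17] -/
theorem euler_ode_solution {a p q : ℝ → ℂ} {s : ℝ} (hs : s ≠ 1 / 2)
    (ha : ∀ y : ℝ, 0 < y → HasDerivAt a (p y) y) (hp : ∀ y : ℝ, 0 < y → HasDerivAt p (q y) y)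
    (hq : ∀ y : ℝ, 0 < y → (y : ℂ) ^ 2 * q y = -(((s * (1 - s) : ℝ)) : ℂ) * a y) :
    ∃ A B : ℂ, ∀ y : ℝ, 0 < y → a y = A * ((y ^ s : ℝ) : ℂ) + B * ((y ^ (1 - s) : ℝ) : ℂ) := by
  -- first integral: `c = p y^{1-s} + (s-1) a y^{-s}` is constant
  set c : ℝ → ℂ := fun y => p y * ((y ^ (1 - s) : ℝ) : ℂ) +
    ((s - 1 : ℝ) : ℂ) * a y * ((y ^ (-s) : ℝ) : ℂ) with hc_def
  have hc : ∀ y : ℝ, 0 < y → HasDerivAt c 0 y := by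
    intro y hy
    have h := ((hp y hy).fun_mul (hasDerivAt_ofReal_rpow hy (1 - s))).fun_add
      (((ha y hy).const_mul ((s - 1 : ℝ) : ℂ)).fun_mul (hasDerivAt_ofReal_rpow hy (-s)))
    refine h.congr_deriv ?_
    have e1 : ((y ^ (1 - s) : ℝ) : ℂ) = (y : ℂ) ^ 2 * ((y ^ (-s - 1) : ℝ) : ℂ) := by
      rw [show (1 - s : ℝ) = 2 + (-s - 1) by ring, Real.rpow_add hy, Real.rpow_two]
      push_cast; ring
    have e2 : ((y ^ (1 - s - 1) : ℝ) : ℂ) = (y : ℂ) * ((y ^ (-s - 1) : ℝ) : ℂ) := by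
      rw [show (1 - s - 1 : ℝ) = 1 + (-s - 1) by ring, Real.rpow_add hy, Real.rpow_one]
      push_cast; ring
    have e3 : ((y ^ (-s) : ℝ) : ℂ) = (y : ℂ) * ((y ^ (-s - 1) : ℝ) : ℂ) := by
      rw [show (-s : ℝ) = 1 + (-s - 1) by ring, Real.rpow_add hy, Real.rpow_one]
      push_cast; ring
    have hq' := hq y hy
    push_cast at hq' ⊢
    rw [e1, e2, e3]
    linear_combination (((y ^ (-s - 1) : ℝ) : ℂ)) * hq'
  obtain ⟨K, hK⟩ := exists_const_of_hasDerivAt_zero_Ioi hc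
  have h2s : (2 * s - 1 : ℂ) ≠ 0 := by
    have : (2 * s - 1 : ℝ) ≠ 0 := by
      intro h; apply hs; linarith
    exact_mod_cast this
  set A : ℂ := K / (2 * s - 1) with hA
  have hKA : K = A * (2 * s - 1) := by rw [hA, div_mul_cancel₀ K h2s]
  -- second integral: `d = a y^{s-1} - A y^{2s-1}` is constant
  set d : ℝ → ℂ := fun y => a y * ((y ^ (s - 1) : ℝ) : ℂ) - A * ((y ^ (2 * s - 1) : ℝ) : ℂ)
    with hd_def
  have hd : ∀ y : ℝ, 0 < y → HasDerivAt d 0 y := by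
    intro y hy
    have h := ((ha y hy).fun_mul (hasDerivAt_ofReal_rpow hy (s - 1))).fun_sub
      ((hasDerivAt_ofReal_rpow hy (2 * s - 1)).const_mul A)
    refine h.congr_deriv ?_
    have hKy : c y = K := hK y hy
    simp only [hc_def] at hKy
    rw [hKA] at hKy
    have m1 : ((y ^ (1 - s) : ℝ) : ℂ) * ((y ^ (2 * s - 1 - 1) : ℝ) : ℂ) =
        ((y ^ (s - 1) : ℝ) : ℂ) := by
      rw [← Complex.ofReal_mul, ← Real.rpow_add hy]; ring_nf
    have m2 : ((y ^ (-s) : ℝ) : ℂ) * ((y ^ (2 * s - 1 - 1) : ℝ) : ℂ) =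
        ((y ^ (s - 1 - 1) : ℝ) : ℂ) := by
      rw [← Complex.ofReal_mul, ← Real.rpow_add hy]; ring_nf
    push_cast at hKy ⊢
    linear_combination (((y ^ (2 * s - 1 - 1) : ℝ) : ℂ)) * hKy - p y * m1 -
      (((s : ℂ) - 1) * a y) * m2
  obtain ⟨B, hB⟩ := exists_const_of_hasDerivAt_zero_Ioi hd
  refine ⟨A, B, fun y hy => ?_⟩
  have hBy := hB y hy
  simp only [hd_def] at hBy
  have m3 : ((y ^ (s - 1) : ℝ) : ℂ) * ((y ^ (1 - s) : ℝ) : ℂ) = 1 := by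
    rw [← Complex.ofReal_mul, ← Real.rpow_add hy]; norm_num
  have m4 : ((y ^ (2 * s - 1) : ℝ) : ℂ) * ((y ^ (1 - s) : ℝ) : ℂ) = ((y ^ s : ℝ) : ℂ) := by
    rw [← Complex.ofReal_mul, ← Real.rpow_add hy]; ring_nf
  linear_combination (((y ^ (1 - s) : ℝ) : ℂ)) * hBy - a y * m3 + A * m4

end EulerODE

/-! ### The zero-th Fourier mode of a periodic eigenfunction satisfies the Euler equation -/

section ZeroMode

open Laplacian

variable {F : ℂ → ℂ}

/-- `1`-periodicity on the upper half-plane passes to the derivative.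
[folklore] -/
theorem fderiv_periodic (hper : ∀ z : ℂ, 0 < z.im → F (z + 1) = F z) {w : ℂ} (hw : 0 < w.im) :
    fderiv ℝ F (w + 1) = fderiv ℝ F w := by
  have h : (fun z => F (z + 1)) =ᶠ[𝓝 w] F := by
    filter_upwards [UpperHalfPlane.isOpen_upperHalfPlaneSet.mem_nhds hw] with z hz
    exact hper z hz
  rw [← h.fderiv_eq, fderiv_comp_add_right]

/-- `Im (x + iy) = y > 0`. [folklore] -/
theorem im_pos_of_pt {x y : ℝ} (hy : 0 < y) : 0 < ((x : ℂ) + (y : ℂ) * Complex.I).im := by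
  simpa using hy

variable (hF : ContDiffOn ℝ 2 F {z : ℂ | 0 < z.im})
include hF

/-- For `C²` `F`, `F'` is differentiable on the upper half-plane. [folklore] -/
theorem differentiableAt_fderiv_of_C2 {w : ℂ} (hw : 0 < w.im) :
    DifferentiableAt ℝ (fderiv ℝ F) w :=
  ((hF.contDiffAt (UpperHalfPlane.isOpen_upperHalfPlaneSet.mem_nhds hw)).fderiv_right (m := 1) (by norm_num)
    ).differentiableAt (by norm_num)

/-- For `C²` `F`, `F` is differentiable on the upper half-plane. [folklore] -/
theorem differentiableAt_of_C2 {w : ℂ} (hw : 0 < w.im) : DifferentiableAt ℝ F w :=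
  (hF.contDiffAt (UpperHalfPlane.isOpen_upperHalfPlaneSet.mem_nhds hw)).differentiableAt (by norm_num)

/-- For `C²` `F`, `F''` is continuous on the upper half-plane. [folklore] -/
theorem continuousOn_fderiv_fderiv_of_C2 :
    ContinuousOn (fderiv ℝ (fderiv ℝ F)) {z : ℂ | 0 < z.im} :=
  (hF.fderiv_of_isOpen UpperHalfPlane.isOpen_upperHalfPlaneSet (m := 1) (by norm_num)).continuousOn_fderiv_of_isOpen
    UpperHalfPlane.isOpen_upperHalfPlaneSet le_rfl

/-- Continuity of `x ↦ F''(x+iy) u u'` for `y > 0`. [folklore] -/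
theorem continuous_fderiv_fderiv_horizontal {y : ℝ} (hy : 0 < y) (u u' : ℂ) :
    Continuous fun x : ℝ =>
      fderiv ℝ (fderiv ℝ F) ((x : ℂ) + (y : ℂ) * Complex.I) u u' := by
  have h := (continuousOn_fderiv_fderiv_of_C2 hF).comp_continuous
    (f := fun x : ℝ => (x : ℂ) + (y : ℂ) * Complex.I) (by fun_prop) (fun x => im_pos_of_pt hy)
  exact (h.clm_apply continuous_const).clm_apply continuous_const

/-- `∫₀¹ F_xx(x+iy) dx = 0` for a `1`-periodic `C²` function.
[folklore] -/
theorem integral_fderiv_fderiv_one_one (hper : ∀ z : ℂ, 0 < z.im → F (z + 1) = F z) {y : ℝ}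
    (hy : 0 < y) :
    ∫ x in (0 : ℝ)..1, fderiv ℝ (fderiv ℝ F) ((x : ℂ) + (y : ℂ) * Complex.I) 1 1 = 0 := by
  set G : ℂ → ℂ := fun w => fderiv ℝ F w 1 with hG
  have hGd : ∀ x : ℝ, HasDerivAt (fun t : ℝ => G ((t : ℂ) + (y : ℂ) * Complex.I))
      (fderiv ℝ (fderiv ℝ F) ((x : ℂ) + (y : ℂ) * Complex.I) 1 1) x := by
    intro x
    have hd1 := differentiableAt_fderiv_of_C2 hF (im_pos_of_pt (x := x) hy)
    have hGdiff : DifferentiableAt ℝ G ((x : ℂ) + (y : ℂ) * Complex.I) :=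
      (hasFDerivAt_fderiv_apply 1 hd1).differentiableAt
    have h := hasDerivAt_comp_horizontal (G := G) hGdiff
    rw [hG, fderiv_fderiv_apply 1 1 hd1] at h
    exact h
  rw [intervalIntegral.integral_eq_sub_of_hasDerivAt (fun x _ => hGd x)
    ((continuous_fderiv_fderiv_horizontal hF hy 1 1).intervalIntegrable _ _)]
  have hp := fderiv_periodic hper (w := (y : ℂ) * Complex.I) (by simpa using hy)
  simp only [hG, Complex.ofReal_one, Complex.ofReal_zero, zero_add]
  rw [add_comm, hp, sub_self]

/-- The zero-th mode `a(y) = ∫₀¹ F(x+iy) dx` has derivative `p(y) = ∫₀¹ F_y(x+iy) dx`.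
[folklore] -/
theorem hasDerivAt_zeroMode {y : ℝ} (hy : 0 < y) :
    HasDerivAt (fun t : ℝ => ∫ x in (0 : ℝ)..1, F ((x : ℂ) + (t : ℂ) * Complex.I))
      (∫ x in (0 : ℝ)..1, fderiv ℝ F ((x : ℂ) + (y : ℂ) * Complex.I) Complex.I) y :=
  hasDerivAt_integral_vertical (hF.of_le (by norm_num)) hy

/-- `p(y) = ∫₀¹ F_y(x+iy) dx` has derivative `q(y) = ∫₀¹ F_yy(x+iy) dx`.
[folklore] -/
theorem hasDerivAt_firstMode {y : ℝ} (hy : 0 < y) :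
    HasDerivAt (fun t : ℝ => ∫ x in (0 : ℝ)..1, fderiv ℝ F ((x : ℂ) + (t : ℂ) * Complex.I) Complex.I)
      (∫ x in (0 : ℝ)..1,
        fderiv ℝ (fderiv ℝ F) ((x : ℂ) + (y : ℂ) * Complex.I) Complex.I Complex.I) y := by
  set G : ℂ → ℂ := fun w => fderiv ℝ F w Complex.I with hG
  have hG1 : ContDiffOn ℝ 1 G {z : ℂ | 0 < z.im} :=
    (hF.fderiv_of_isOpen UpperHalfPlane.isOpen_upperHalfPlaneSet (m := 1) (by norm_num)).clm_apply contDiffOn_const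
  have h := hasDerivAt_integral_vertical hG1 hy
  have heq : (∫ x in (0 : ℝ)..1, fderiv ℝ G ((x : ℂ) + (y : ℂ) * Complex.I) Complex.I) =
      ∫ x in (0 : ℝ)..1,
        fderiv ℝ (fderiv ℝ F) ((x : ℂ) + (y : ℂ) * Complex.I) Complex.I Complex.I := by
    apply intervalIntegral.integral_congr
    intro x _
    simp only [hG]
    exact fderiv_fderiv_apply Complex.I Complex.I
      (differentiableAt_fderiv_of_C2 hF (im_pos_of_pt (x := x) hy))
  rw [heq] at h
  exact h

/-- The eigen-equation integrated over a period: `y² q(y) = -l a(y)`.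
[cite: Iwaniec2002, (1.22)–(1.23) & (3.5), PDF pp. 16–17, 41] -/
theorem sq_mul_secondMode {l : ℝ} (hper : ∀ z : ℂ, 0 < z.im → F (z + 1) = F z)
    (heig : ∀ z : ℂ, 0 < z.im → (z.im : ℂ) ^ 2 * Δ F z + l * F z = 0) {y : ℝ} (hy : 0 < y) :
    (y : ℂ) ^ 2 * ∫ x in (0 : ℝ)..1,
        fderiv ℝ (fderiv ℝ F) ((x : ℂ) + (y : ℂ) * Complex.I) Complex.I Complex.I =
      -(l : ℂ) * ∫ x in (0 : ℝ)..1, F ((x : ℂ) + (y : ℂ) * Complex.I) := by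
  have hpt : ∀ x : ℝ, (y : ℂ) ^ 2 *
      fderiv ℝ (fderiv ℝ F) ((x : ℂ) + (y : ℂ) * Complex.I) Complex.I Complex.I =
      -(l : ℂ) * F ((x : ℂ) + (y : ℂ) * Complex.I) -
        (y : ℂ) ^ 2 * fderiv ℝ (fderiv ℝ F) ((x : ℂ) + (y : ℂ) * Complex.I) 1 1 := by
    intro x
    have h := heig ((x : ℂ) + (y : ℂ) * Complex.I) (im_pos_of_pt hy)
    rw [laplacian_eq_fderiv_fderiv] at h
    have him : (((x : ℂ) + (y : ℂ) * Complex.I).im : ℂ) = (y : ℂ) := by simp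
    rw [him] at h
    linear_combination h
  have hcF : Continuous fun x : ℝ => F ((x : ℂ) + (y : ℂ) * Complex.I) :=
    continuous_comp_horizontal hF.continuousOn hy
  rw [← intervalIntegral.integral_const_mul]
  simp_rw [hpt]
  rw [intervalIntegral.integral_sub ((hcF.const_mul _).intervalIntegrable _ _)
    (((continuous_fderiv_fderiv_horizontal hF hy 1 1).const_mul _).intervalIntegrable _ _),
    intervalIntegral.integral_const_mul, intervalIntegral.integral_const_mul,
    integral_fderiv_fderiv_one_one hF hper hy, mul_zero, sub_zero]

/-- **Zero-th Fourier mode of a periodic eigenfunction** (Iwaniec, Thm 3.1 / (3.5) for the zero-th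
term): if `F` is `C²` and `1`-periodic on the upper half-plane with `y² ΔF + s(1-s) F = 0`,
`s ≠ 1/2`, then `∫₀¹ F(x+iy) dx = A y^s + B y^{1-s}`.
[cite: Iwaniec2002, Thm 3.1 (3.4)–(3.5), PDF p. 41] -/
theorem zeroMode_eq_rpow {l s : ℝ} (hper : ∀ z : ℂ, 0 < z.im → F (z + 1) = F z)
    (heig : ∀ z : ℂ, 0 < z.im → (z.im : ℂ) ^ 2 * Δ F z + l * F z = 0) (hs : s ≠ 1 / 2)
    (hls : l = s * (1 - s)) :
    ∃ A B : ℂ, ∀ y : ℝ, 0 < y →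
      (∫ x in (0 : ℝ)..1, F ((x : ℂ) + (y : ℂ) * Complex.I)) =
        A * ((y ^ s : ℝ) : ℂ) + B * ((y ^ (1 - s) : ℝ) : ℂ) := by
  refine euler_ode_solution hs (fun y hy => hasDerivAt_zeroMode hF hy)
    (fun y hy => hasDerivAt_firstMode hF hy) (fun y hy => ?_)
  subst hls
  exact sq_mul_secondMode hF hper heig hy

end ZeroMode

/-! ### Square-integrability on `𝒟` controls the strip `|x| ≤ 1/2, y ≥ 1` -/

section Strip

open UpperHalfPlane
open scoped Modular NNReal ENNReal

/-- Transfer of set integrals on `ℍ` to `ℂ` with the density `y⁻²` (the set-restricted variant of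
`lintegral_upperHalfPlane_eq` / `setLIntegral_upperHalf_eq_iterated` of `EisensteinOrthogonality.lean`,
which lies outside this file's import closure; same normalisation `dμ = y⁻² dx dy`).
[folklore] -/
theorem setLIntegral_upperHalfPlane (g : ℍ → ℝ≥0∞) (hg : Measurable g) {S : Set ℍ}
    (hS : MeasurableSet S) :
    ∫⁻ z in S, g z = ∫⁻ w in ((↑) '' S : Set ℂ), g (ofComplex w) * ↑((1 / ‖w.im‖₊) ^ 2 : ℝ≥0) := by
  have hmp : MeasurePreserving UpperHalfPlane.coe (volume.comap UpperHalfPlane.coe)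
      (volume.restrict (range UpperHalfPlane.coe)) :=
    ⟨measurable_coe, by rw [measurableEmbedding_coe.map_comap]⟩
  have hc : Continuous fun z : ℍ => ((1 / NNReal.mk z.im z.im_pos.le) ^ 2 : ℝ≥0) := by
    refine .pow (.div₀ continuous_const ?_ ?_) _
    · exact UpperHalfPlane.continuous_im.subtype_mk _
    · exact fun x => NNReal.ne_iff.mp x.im_ne_zero
  have hρ : Measurable fun z : ℍ => (((1 / NNReal.mk z.im z.im_pos.le) ^ 2 : ℝ≥0) : ℝ≥0∞) :=
    (ENNReal.continuous_coe.comp hc).measurable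
  rw [volume_def, restrict_withDensity hS, lintegral_withDensity_eq_lintegral_mul _ hρ hg]
  have hfun : ((fun z : ℍ => (((1 / NNReal.mk z.im z.im_pos.le) ^ 2 : ℝ≥0) : ℝ≥0∞)) * g) =
      fun z : ℍ => (fun w : ℂ => g (ofComplex w) * ↑((1 / ‖w.im‖₊) ^ 2 : ℝ≥0)) (z : ℂ) := by
    funext z
    simp only [Pi.mul_apply, ofComplex_apply, mul_comm (g z)]
    congr 2
    ext
    simp [Real.nnnorm_of_nonneg z.im_pos.le]
  rw [hfun, hmp.setLIntegral_comp_emb measurableEmbedding_coe, Measure.restrict_restrict',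
    inter_eq_self_of_subset_left (image_subset_range _ _)]
  exact measurableEmbedding_coe.measurableSet_range

/-- The strip `{|x| ≤ 1/2, y ≥ 1}` (Mathlib's `UpperHalfPlane.verticalStrip (1/2) 1`) lies in the
standard fundamental domain `𝒟`. [folklore] -/
theorem verticalStrip_half_one_subset_fd : verticalStrip (1 / 2) 1 ⊆ 𝒟 := by
  rintro z ⟨h1, h2⟩
  refine ⟨?_, h1⟩
  rw [Complex.normSq_apply]
  have : 0 ≤ z.re * z.re := mul_self_nonneg _
  have h3 : (1 : ℝ) ≤ z.im * z.im := by
    have := z.im_pos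
    nlinarith
  change 1 ≤ (z : ℂ).re * (z : ℂ).re + (z : ℂ).im * (z : ℂ).im
  simp only [UpperHalfPlane.coe_re, UpperHalfPlane.coe_im]
  linarith

/-- The strip `verticalStrip (1/2) 1` is closed. [folklore] -/
theorem isClosed_verticalStrip_half_one : IsClosed (verticalStrip (1 / 2) 1) := by
  apply IsClosed.inter
  · exact isClosed_le (continuous_abs.comp UpperHalfPlane.continuous_re) continuous_const
  · exact isClosed_le continuous_const UpperHalfPlane.continuous_im

/-- The image of the strip `verticalStrip (1/2) 1` in `ℂ`. [folklore] -/
theorem coe_image_verticalStrip_half_one :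
    ((↑) '' verticalStrip (1 / 2) 1 : Set ℂ) = {w : ℂ | |w.re| ≤ 1 / 2 ∧ 1 ≤ w.im} := by
  ext w
  constructor
  · rintro ⟨z, ⟨h1, h2⟩, rfl⟩
    exact ⟨h1, h2⟩
  · rintro ⟨h1, h2⟩
    exact ⟨⟨w, by linarith⟩, ⟨h1, h2⟩, rfl⟩

/-- **Square-integrability on `𝒟` bounds the strip integral**: if `|v|²` is integrable on `𝒟`
then `∫_{y ≥ 1} y⁻² ∫_{|x| ≤ 1/2} |v(x+iy)|² dx dy < ∞`.
[folklore] -/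
theorem lintegral_verticalStrip_lt_top {v : ℍ → ℂ} (hvc : Continuous v)
    (hvU : ContinuousOn (v ∘ ofComplex) {z : ℂ | 0 < z.im})
    (hint : IntegrableOn (fun z : ℍ => ‖v z‖ ^ 2) 𝒟) :
    ∫⁻ y in Ici (1 : ℝ), ENNReal.ofReal (y ^ (-2 : ℝ)) *
        ∫⁻ x in Icc (-(1 / 2 : ℝ)) (1 / 2),
          ENNReal.ofReal (‖(v ∘ ofComplex) ((x : ℂ) + (y : ℂ) * Complex.I)‖ ^ 2) < ⊤ := by
  -- step 1: finiteness on the strip in `ℍ`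
  have hS : MeasurableSet (verticalStrip (1 / 2) 1) := isClosed_verticalStrip_half_one.measurableSet
  have h1 : ∫⁻ z in verticalStrip (1 / 2) 1, ENNReal.ofReal (‖v z‖ ^ 2) < ⊤ :=
    (hint.mono_set verticalStrip_half_one_subset_fd).lintegral_lt_top
  -- step 2: transfer to `ℂ`
  have hg : Measurable fun z : ℍ => ENNReal.ofReal (‖v z‖ ^ 2) :=
    ENNReal.measurable_ofReal.comp ((continuous_norm.comp hvc).pow 2).measurable
  rw [setLIntegral_upperHalfPlane _ hg hS, coe_image_verticalStrip_half_one] at h1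
  set T : Set ℂ := {w : ℂ | |w.re| ≤ 1 / 2 ∧ 1 ≤ w.im} with hT
  have hTm : MeasurableSet T := by
    apply IsClosed.measurableSet
    apply IsClosed.inter
    · exact isClosed_le (continuous_abs.comp Complex.continuous_re) continuous_const
    · exact isClosed_le continuous_const Complex.continuous_im
  set H : ℂ → ℝ≥0∞ := fun w =>
    ENNReal.ofReal (‖(v ∘ ofComplex) w‖ ^ 2 * w.im ^ (-2 : ℝ)) with hH
  have h2 : ∫⁻ w in T, ENNReal.ofReal (‖v (ofComplex w)‖ ^ 2) * ↑((1 / ‖w.im‖₊) ^ 2 : ℝ≥0) =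
      ∫⁻ w in T, H w := by
    apply setLIntegral_congr_fun hTm
    intro w hw
    have hw0 : 0 < w.im := by have := hw.2; linarith
    simp only [hH, Function.comp_apply, ennreal_inv_nnnorm_sq hw0,
      ← ENNReal.ofReal_mul (sq_nonneg _)]
  rw [h2] at h1
  -- step 3: to `ℝ × ℝ`
  have hmp := Complex.volume_preserving_equiv_real_prod.symm
  rw [← hmp.setLIntegral_comp_preimage_emb
    Complex.measurableEquivRealProd.symm.measurableEmbedding] at h1
  set T' : Set (ℝ × ℝ) := {p | |p.1| ≤ 1 / 2 ∧ 1 ≤ p.2} with hT'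
  have hpre : Complex.measurableEquivRealProd.symm ⁻¹' T = T' := by
    ext p; simp [hT, hT', Complex.measurableEquivRealProd_symm_apply]
  rw [hpre] at h1
  have hT'm : MeasurableSet T' := by
    apply IsClosed.measurableSet
    apply IsClosed.inter
    · exact isClosed_le (continuous_abs.comp continuous_fst) continuous_const
    · exact isClosed_le continuous_const continuous_snd
  set G : ℝ × ℝ → ℝ≥0∞ := fun p =>
    ENNReal.ofReal (‖(v ∘ ofComplex) ((p.1 : ℂ) + (p.2 : ℂ) * Complex.I)‖ ^ 2 *
      p.2 ^ (-2 : ℝ)) with hG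
  have hHG : (fun p : ℝ × ℝ => H (Complex.measurableEquivRealProd.symm p)) = G := by
    funext p
    simp [hH, hG, Complex.measurableEquivRealProd_symm_apply, Complex.mk_eq_add_mul_I]
  rw [hHG] at h1
  -- step 4: measurability of the indicator and Tonelli with `y` outside
  have hGc : ContinuousOn G T' := by
    have hmap : ∀ p ∈ T', ((p.1 : ℂ) + (p.2 : ℂ) * Complex.I) ∈ {z : ℂ | 0 < z.im} := by
      intro p hp
      have : (1 : ℝ) ≤ p.2 := hp.2
      simpa using (by linarith : (0 : ℝ) < p.2)
    have hA : ContinuousOn (fun p : ℝ × ℝ =>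
        ‖(v ∘ ofComplex) ((p.1 : ℂ) + (p.2 : ℂ) * Complex.I)‖ ^ 2) T' := by
      have := hvU.comp (Continuous.continuousOn (s := T') (by fun_prop)) hmap
      exact (continuous_norm.comp_continuousOn this).pow 2
    have hB : ContinuousOn (fun p : ℝ × ℝ => p.2 ^ (-2 : ℝ)) T' := by
      intro p hp
      have hp2 : p.2 ≠ 0 := by have : (1 : ℝ) ≤ p.2 := hp.2; positivity
      exact ((Real.continuousAt_rpow_const p.2 (-2) (Or.inl hp2)).comp
        continuousAt_snd).continuousWithinAt
    exact ENNReal.continuous_ofReal.comp_continuousOn (hA.mul hB)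
  have hGi : AEMeasurable (T'.indicator G) (volume : Measure (ℝ × ℝ)) :=
    (aemeasurable_indicator_iff hT'm).mpr (hGc.aemeasurable hT'm)
  rw [← lintegral_indicator hT'm, Measure.volume_eq_prod, lintegral_prod_symm _ hGi] at h1
  -- step 5: the fibres
  have fib : ∀ y : ℝ, ∫⁻ x, T'.indicator G (x, y) =
      (Ici (1 : ℝ)).indicator (fun y => ENNReal.ofReal (y ^ (-2 : ℝ)) *
        ∫⁻ x in Icc (-(1 / 2 : ℝ)) (1 / 2),
          ENNReal.ofReal (‖(v ∘ ofComplex) ((x : ℂ) + (y : ℂ) * Complex.I)‖ ^ 2)) y := by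
    intro y
    by_cases hy : 1 ≤ y
    · rw [indicator_of_mem (show y ∈ Ici (1 : ℝ) from hy)]
      have hind : ∀ x : ℝ, T'.indicator G (x, y) = (Icc (-(1 / 2 : ℝ)) (1 / 2)).indicator
          (fun x => ENNReal.ofReal (‖(v ∘ ofComplex) ((x : ℂ) + (y : ℂ) * Complex.I)‖ ^ 2) *
            ENNReal.ofReal (y ^ (-2 : ℝ))) x := by
        intro x
        by_cases hx : |x| ≤ 1 / 2
        · rw [indicator_of_mem (show (x, y) ∈ T' from ⟨hx, hy⟩),
            indicator_of_mem (show x ∈ Icc (-(1 / 2 : ℝ)) (1 / 2) from abs_le.mp hx), hG]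
          simp only
          rw [ENNReal.ofReal_mul (sq_nonneg _)]
        · rw [indicator_of_notMem (show (x, y) ∉ T' from fun h => hx h.1),
            indicator_of_notMem (show x ∉ Icc (-(1 / 2 : ℝ)) (1 / 2) from
              fun h => hx (abs_le.mpr h))]
      simp_rw [hind]
      rw [lintegral_indicator measurableSet_Icc, lintegral_mul_const', mul_comm]
      exact ENNReal.ofReal_ne_top
    · rw [indicator_of_notMem (show y ∉ Ici (1 : ℝ) from hy)]
      have : ∀ x : ℝ, T'.indicator G (x, y) = 0 := fun x =>
        indicator_of_notMem (fun h => hy h.2) _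
      simp [this]
  simp_rw [fib] at h1
  rwa [lintegral_indicator measurableSet_Ici] at h1

end Strip

/-! ### Jensen on a unit interval, and non-integrability of `y^{2s-2}` -/

section Tail

open scoped NNReal ENNReal ComplexConjugate

/-- `‖∫_a^{a+1} f‖² ≤ ∫_a^{a+1} ‖f‖²` for `f` continuous on `[a, a+1]` (variance is non-negative).
[folklore] -/
theorem norm_sq_intervalIntegral_le {f : ℝ → ℂ} {a : ℝ} (hf : ContinuousOn f (Set.Icc a (a + 1))) :
    ‖∫ x in a..(a + 1), f x‖ ^ 2 ≤ ∫ x in a..(a + 1), ‖f x‖ ^ 2 := by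
  have hab : a ≤ a + 1 := by linarith
  have hfi : IntervalIntegrable f volume a (a + 1) :=
    (hf.mono (by rw [uIcc_of_le hab])).intervalIntegrable
  set m : ℂ := ∫ x in a..(a + 1), f x with hm
  have hcn : ContinuousOn (fun x => ‖f x‖ ^ 2) (uIcc a (a + 1)) := by
    rw [uIcc_of_le hab]; exact (continuous_norm.comp_continuousOn hf).pow 2
  have hcs : ContinuousOn (fun x => ‖f x - m‖ ^ 2) (uIcc a (a + 1)) := by
    rw [uIcc_of_le hab]
    exact (continuous_norm.comp_continuousOn (hf.sub continuousOn_const)).pow 2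
  have hcr : ContinuousOn (fun x => (f x * conj m).re) (uIcc a (a + 1)) := by
    rw [uIcc_of_le hab]
    exact Complex.continuous_re.comp_continuousOn (hf.mul continuousOn_const)
  have h0 : 0 ≤ ∫ x in a..(a + 1), ‖f x - m‖ ^ 2 :=
    intervalIntegral.integral_nonneg hab fun x _ => sq_nonneg _
  have hexp : ∀ x, ‖f x - m‖ ^ 2 = ‖f x‖ ^ 2 + ‖m‖ ^ 2 - 2 * (f x * conj m).re := by
    intro x
    rw [Complex.sq_norm, Complex.sq_norm, Complex.sq_norm, Complex.normSq_sub]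
  have hre : ∫ x in a..(a + 1), (f x * conj m).re = ‖m‖ ^ 2 := by
    have h1 : ∫ x in a..(a + 1), (f x * conj m).re =
        (∫ x in a..(a + 1), f x * conj m).re := by
      have := intervalIntegral.intervalIntegral_re (hfi.mul_const (conj m))
      simpa using this
    rw [h1, intervalIntegral.integral_mul_const, ← hm, Complex.mul_conj, Complex.sq_norm]
    norm_cast
  have hcalc : ∫ x in a..(a + 1), ‖f x - m‖ ^ 2 =
      (∫ x in a..(a + 1), ‖f x‖ ^ 2) - ‖m‖ ^ 2 := by
    simp_rw [hexp]
    rw [intervalIntegral.integral_sub (hcn.intervalIntegrable.add intervalIntegrable_const)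
        ((hcr.intervalIntegrable).const_mul 2),
      intervalIntegral.integral_add hcn.intervalIntegrable intervalIntegrable_const,
      intervalIntegral.integral_const_mul, hre, intervalIntegral.integral_const]
    simp
    ring
  linarith

/-- From `∫_{y ≥ 1} y⁻² ‖A y^s + B y^{1-s}‖² dy < ∞` and `s > 1/2` it follows that `A = 0`
(the solution `y^s` is not square-integrable at the cusp).
[cite: Iwaniec2002, Thm 3.2 (proof), PDF p. 42] -/
theorem coeff_eq_zero_of_lintegral_lt_top {A B : ℂ} {s : ℝ} (hs : 1 / 2 < s) {a : ℝ → ℂ}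
    (ha : ∀ y : ℝ, 0 < y → a y = A * ((y ^ s : ℝ) : ℂ) + B * ((y ^ (1 - s) : ℝ) : ℂ))
    (hfin : ∫⁻ y in Ici (1 : ℝ), ENNReal.ofReal (y ^ (-2 : ℝ)) * ENNReal.ofReal (‖a y‖ ^ 2) < ⊤) :
    A = 0 := by
  by_contra hA
  have hA0 : 0 < ‖A‖ := norm_pos_iff.mpr hA
  -- choose `Y₀ ≥ 1` with `2‖B‖ ≤ ‖A‖ y^{2s-1}` for `y ≥ Y₀`
  have hev : ∀ᶠ y : ℝ in atTop, 2 * ‖B‖ / ‖A‖ ≤ y ^ (2 * s - 1) :=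
    (tendsto_rpow_atTop (by linarith)).eventually_ge_atTop _
  obtain ⟨N, hN⟩ := Filter.eventually_atTop.mp hev
  set Y₀ : ℝ := max N 1 with hY₀
  have hY₀1 : 1 ≤ Y₀ := le_max_right _ _
  have hY₀pos : 0 < Y₀ := by linarith
  -- pointwise lower bound on `[Y₀, ∞)`
  have hlow : ∀ y ∈ Ici Y₀, ENNReal.ofReal (‖A‖ ^ 2 / 4 * y ^ (-1 : ℝ)) ≤
      ENNReal.ofReal (y ^ (-2 : ℝ)) * ENNReal.ofReal (‖a y‖ ^ 2) := by
    intro y hy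
    have hy1 : 1 ≤ y := le_trans hY₀1 hy
    have hy0 : 0 < y := by linarith
    have hNy : 2 * ‖B‖ / ‖A‖ ≤ y ^ (2 * s - 1) := hN y (le_trans (le_max_left _ _) hy)
    have hB : ‖B‖ * y ^ (1 - s) ≤ ‖A‖ / 2 * y ^ s := by
      have h1 : 2 * ‖B‖ ≤ ‖A‖ * y ^ (2 * s - 1) := by
        rw [div_le_iff₀ hA0] at hNy; linarith
      have h2 : y ^ (2 * s - 1) * y ^ (1 - s) = y ^ s := by
        rw [← Real.rpow_add hy0]; ring_nf
      have h3 : 0 ≤ y ^ (1 - s) := Real.rpow_nonneg hy0.le _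
      nlinarith [mul_le_mul_of_nonneg_right h1 h3]
    have hnorm : ‖A‖ / 2 * y ^ s ≤ ‖a y‖ := by
      rw [ha y hy0]
      have h := norm_sub_le (A * ((y ^ s : ℝ) : ℂ) + B * ((y ^ (1 - s) : ℝ) : ℂ))
        (B * ((y ^ (1 - s) : ℝ) : ℂ))
      simp only [add_sub_cancel_right] at h
      rw [norm_mul, norm_mul, Complex.norm_real, Complex.norm_real,
        Real.norm_of_nonneg (Real.rpow_nonneg hy0.le _),
        Real.norm_of_nonneg (Real.rpow_nonneg hy0.le _)] at h
      linarith
    have hsq : ‖A‖ ^ 2 / 4 * y ≤ ‖a y‖ ^ 2 := by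
      have h1 : y ^ (1 / 2 : ℝ) ≤ y ^ s := Real.rpow_le_rpow_of_exponent_le hy1 hs.le
      have h2 : (y ^ (1 / 2 : ℝ)) ^ 2 = y := by
        rw [← Real.sqrt_eq_rpow, Real.sq_sqrt hy0.le]
      have h3 : 0 ≤ ‖A‖ / 2 * y ^ (1 / 2 : ℝ) := by positivity
      have h4 : ‖A‖ / 2 * y ^ (1 / 2 : ℝ) ≤ ‖a y‖ := le_trans (by gcongr) hnorm
      nlinarith [pow_le_pow_left₀ h3 h4 2]
    rw [← ENNReal.ofReal_mul (Real.rpow_nonneg hy0.le _)]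
    apply ENNReal.ofReal_le_ofReal
    have h5 : y ^ (-1 : ℝ) = y ^ (-2 : ℝ) * y := by
      rw [show (-1 : ℝ) = -2 + 1 by norm_num, Real.rpow_add hy0, Real.rpow_one]
    rw [h5]
    have h6 : 0 ≤ y ^ (-2 : ℝ) := Real.rpow_nonneg hy0.le _
    nlinarith [mul_le_mul_of_nonneg_left hsq h6]
  -- the lower bound is not integrable
  have hnot : ¬ IntegrableOn (fun y : ℝ => y ^ (-1 : ℝ)) (Ioi Y₀) := by
    rw [integrableOn_Ioi_rpow_iff hY₀pos]; norm_num
  have hmeas : AEStronglyMeasurable (fun y : ℝ => y ^ (-1 : ℝ)) (volume.restrict (Ioi Y₀)) :=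
    (continuousOn_id.rpow_const fun x hx => Or.inl (ne_of_gt (lt_trans hY₀pos hx))
      ).aestronglyMeasurable measurableSet_Ioi
  have htop : ∫⁻ y in Ioi Y₀, ENNReal.ofReal (y ^ (-1 : ℝ)) = ⊤ := by
    by_contra h
    apply hnot
    refine ⟨hmeas, ?_⟩
    rw [hasFiniteIntegral_iff_enorm]
    have : ∫⁻ y in Ioi Y₀, ‖y ^ (-1 : ℝ)‖ₑ = ∫⁻ y in Ioi Y₀, ENNReal.ofReal (y ^ (-1 : ℝ)) :=
      setLIntegral_congr_fun measurableSet_Ioi fun y hy =>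
        Real.enorm_eq_ofReal (Real.rpow_nonneg (le_of_lt (lt_trans hY₀pos hy)) _)
    rw [this]
    exact lt_top_iff_ne_top.mpr h
  have hc : ENNReal.ofReal (‖A‖ ^ 2 / 4) ≠ 0 := by
    rw [Ne, ENNReal.ofReal_eq_zero, not_le]; positivity
  have hchain : (⊤ : ℝ≥0∞) ≤ ∫⁻ y in Ici (1 : ℝ),
      ENNReal.ofReal (y ^ (-2 : ℝ)) * ENNReal.ofReal (‖a y‖ ^ 2) := by
    calc (⊤ : ℝ≥0∞) = ENNReal.ofReal (‖A‖ ^ 2 / 4) * ⊤ := by rw [ENNReal.mul_top hc]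
      _ = ENNReal.ofReal (‖A‖ ^ 2 / 4) * ∫⁻ y in Ioi Y₀, ENNReal.ofReal (y ^ (-1 : ℝ)) := by
          rw [htop]
      _ = ∫⁻ y in Ioi Y₀, ENNReal.ofReal (‖A‖ ^ 2 / 4 * y ^ (-1 : ℝ)) := by
          rw [← lintegral_const_mul' _ _ ENNReal.ofReal_ne_top]
          apply setLIntegral_congr_fun measurableSet_Ioi
          intro y _
          show ENNReal.ofReal (‖A‖ ^ 2 / 4) * ENNReal.ofReal (y ^ (-1 : ℝ)) =
            ENNReal.ofReal (‖A‖ ^ 2 / 4 * y ^ (-1 : ℝ))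
          rw [ENNReal.ofReal_mul (by positivity)]
      _ ≤ ∫⁻ y in Ici Y₀, ENNReal.ofReal (‖A‖ ^ 2 / 4 * y ^ (-1 : ℝ)) :=
          lintegral_mono_set Ioi_subset_Ici_self
      _ ≤ ∫⁻ y in Ici Y₀, ENNReal.ofReal (y ^ (-2 : ℝ)) * ENNReal.ofReal (‖a y‖ ^ 2) :=
          setLIntegral_mono' measurableSet_Ici hlow
      _ ≤ ∫⁻ y in Ici (1 : ℝ), ENNReal.ofReal (y ^ (-2 : ℝ)) * ENNReal.ofReal (‖a y‖ ^ 2) :=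
          lintegral_mono_set (Ici_subset_Ici.mpr hY₀1)
  exact absurd (lt_of_le_of_lt hchain hfin) (lt_irrefl _)

end Tail

/-! ### Theorem 3.2 (zero-th term) for `L²` Maass forms of the modular group -/

section ZeroTerm

open UpperHalfPlane Laplacian
open scoped Modular MatrixGroups NNReal ENNReal

/-- Periodicity `F(w + 1) = F(w)` of `v ∘ ofComplex` from automorphy under `SL₂(ℤ)`.
[folklore] -/
theorem periodic_of_isAutomorphic {v : ℍ → ℂ}
    (hv : IsAutomorphic (𝒮ℒ : Subgroup (GL (Fin 2) ℝ)) v) (w : ℂ) (hw : 0 < w.im) :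
    (v ∘ ofComplex) (w + 1) = (v ∘ ofComplex) w := by
  have hw1 : 0 < (w + 1).im := by simpa using hw
  have hT := hv (Matrix.SpecialLinearGroup.mapGL ℝ ModularGroup.T) ⟨ModularGroup.T, rfl⟩ ⟨w, hw⟩
  change v (ModularGroup.T • (⟨w, hw⟩ : ℍ)) = v ⟨w, hw⟩ at hT
  rw [UpperHalfPlane.modular_T_smul] at hT
  simp only [Function.comp_apply, ofComplex_apply_of_im_pos hw, ofComplex_apply_of_im_pos hw1]
  convert hT using 2
  ext1
  simp [UpperHalfPlane.coe_vadd, add_comm]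

/-- The eigen-equation on `ℂ`: `(Im w)² ΔF(w) + l F(w) = 0` for `w` in the upper half-plane.
[folklore] -/
theorem eigen_ofComplex {v : ℍ → ℂ} {l : ℝ} (heig : ∀ z : ℍ, hypLaplacian v z + l * v z = 0)
    (w : ℂ) (hw : 0 < w.im) :
    (w.im : ℂ) ^ 2 * Δ (v ∘ ofComplex) w + l * (v ∘ ofComplex) w = 0 := by
  have h := heig ⟨w, hw⟩
  simp only [hypLaplacian] at h
  simpa [Function.comp_apply, ofComplex_apply_of_im_pos hw] using h

/-- Jensen bound for the zero-th mode: `‖a(y)‖² ≤ ∫_{|x| ≤ 1/2} ‖F(x+iy)‖² dx`.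
[folklore] -/
theorem ofReal_norm_sq_zeroMode_le {F : ℂ → ℂ} (hF : ContinuousOn F {z : ℂ | 0 < z.im})
    (hper : ∀ z : ℂ, 0 < z.im → F (z + 1) = F z) {y : ℝ} (hy : 0 < y) :
    ENNReal.ofReal (‖∫ x in (0 : ℝ)..1, F ((x : ℂ) + (y : ℂ) * Complex.I)‖ ^ 2) ≤
      ∫⁻ x in Icc (-(1 / 2 : ℝ)) (1 / 2),
        ENNReal.ofReal (‖F ((x : ℂ) + (y : ℂ) * Complex.I)‖ ^ 2) := by
  set f : ℝ → ℂ := fun x => F ((x : ℂ) + (y : ℂ) * Complex.I) with hf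
  have hfc : Continuous f := continuous_comp_horizontal hF hy
  have hfp : Function.Periodic f 1 := by
    intro x
    simp only [hf]
    have : ((x + 1 : ℝ) : ℂ) + (y : ℂ) * Complex.I = ((x : ℂ) + (y : ℂ) * Complex.I) + 1 := by
      push_cast; ring
    rw [this, hper _ (im_pos_of_pt hy)]
  have hshift : ∫ x in (0 : ℝ)..1, f x = ∫ x in (-(1 / 2 : ℝ))..(-(1 / 2 : ℝ) + 1), f x := by
    have := hfp.intervalIntegral_add_eq 0 (-(1 / 2 : ℝ))
    simpa using this
  change ENNReal.ofReal (‖∫ x in (0 : ℝ)..1, f x‖ ^ 2) ≤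
    ∫⁻ x in Icc (-(1 / 2 : ℝ)) (1 / 2), ENNReal.ofReal (‖f x‖ ^ 2)
  rw [hshift]
  have hJ := norm_sq_intervalIntegral_le (a := -(1 / 2 : ℝ)) hfc.continuousOn
  have hle : (-(1 / 2 : ℝ)) ≤ -(1 / 2 : ℝ) + 1 := by norm_num
  have hi : IntegrableOn (fun x => ‖f x‖ ^ 2) (Ioc (-(1 / 2 : ℝ)) (-(1 / 2 : ℝ) + 1)) :=
    (((continuous_norm.comp hfc).pow 2).integrableOn_Icc).mono_set Ioc_subset_Icc_self
  calc ENNReal.ofReal (‖∫ x in (-(1 / 2 : ℝ))..(-(1 / 2 : ℝ) + 1), f x‖ ^ 2)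
      ≤ ENNReal.ofReal (∫ x in (-(1 / 2 : ℝ))..(-(1 / 2 : ℝ) + 1), ‖f x‖ ^ 2) :=
        ENNReal.ofReal_le_ofReal hJ
    _ = ∫⁻ x in Ioc (-(1 / 2 : ℝ)) (-(1 / 2 : ℝ) + 1), ENNReal.ofReal (‖f x‖ ^ 2) := by
        rw [intervalIntegral.integral_of_le hle,
          ofReal_integral_eq_lintegral_ofReal hi (Eventually.of_forall fun x => sq_nonneg _)]
    _ ≤ ∫⁻ x in Icc (-(1 / 2 : ℝ)) (1 / 2), ENNReal.ofReal (‖f x‖ ^ 2) := by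
        apply lintegral_mono_set
        rw [show (-(1 / 2 : ℝ) + 1) = 1 / 2 by norm_num]
        exact Ioc_subset_Icc_self

/-- **Iwaniec, Theorem 3.2 (zero-th term), for the modular group.** For `v` `C²`, `SL₂(ℤ)`-automorphic,
with `(Δ + s(1-s)) v = 0`, `s > 1/2`, and `|v|²` integrable on `𝒟`, the zero-th Fourier coefficient
is `B y^{1-s}`.
[cite: Iwaniec2002, Thm 3.2, PDF pp. 41–42] -/
theorem zeroCoeff_eq_of_sqIntegrable {v : ℍ → ℂ} {l s : ℝ}
    (hauto : IsAutomorphic (𝒮ℒ : Subgroup (GL (Fin 2) ℝ)) v) (hC2 : IsC2 v)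
    (heig : ∀ z : ℍ, hypLaplacian v z + l * v z = 0)
    (hint : IntegrableOn (fun z : ℍ => ‖v z‖ ^ 2) 𝒟) (hs : 1 / 2 < s) (hls : l = s * (1 - s)) :
    ∃ B : ℂ, ∀ y : ℝ, 0 < y →
      (∫ x in (0 : ℝ)..1, (v ∘ ofComplex) ((x : ℂ) + (y : ℂ) * Complex.I)) =
        B * ((y ^ (1 - s) : ℝ) : ℂ) := by
  set F : ℂ → ℂ := v ∘ ofComplex with hFdef
  have hF : ContDiffOn ℝ 2 F {z : ℂ | 0 < z.im} := hC2
  have hper : ∀ z : ℂ, 0 < z.im → F (z + 1) = F z := periodic_of_isAutomorphic hauto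
  have heig' : ∀ z : ℂ, 0 < z.im → (z.im : ℂ) ^ 2 * Δ F z + l * F z = 0 := eigen_ofComplex heig
  have hs' : s ≠ 1 / 2 := ne_of_gt hs
  obtain ⟨A, B, hAB⟩ := zeroMode_eq_rpow hF hper heig' hs' hls
  -- continuity of `v`
  have hvU : ContinuousOn F {z : ℂ | 0 < z.im} := hF.continuousOn
  have hvc : Continuous v := by
    have h2 : Continuous fun z : ℍ => F (z : ℂ) :=
      hvU.comp_continuous continuous_coe fun z => z.im_pos
    simpa [hFdef, Function.comp_def, ofComplex_apply] using h2
  -- the strip integral is finite, hence so is `∫ y⁻² ‖a(y)‖²`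
  have hstrip := lintegral_verticalStrip_lt_top hvc hvU hint
  have hfin : ∫⁻ y in Ici (1 : ℝ), ENNReal.ofReal (y ^ (-2 : ℝ)) *
      ENNReal.ofReal (‖∫ x in (0 : ℝ)..1, F ((x : ℂ) + (y : ℂ) * Complex.I)‖ ^ 2) < ⊤ := by
    refine lt_of_le_of_lt (setLIntegral_mono' measurableSet_Ici fun y hy => ?_) hstrip
    have hy0 : 0 < y := by have : (1 : ℝ) ≤ y := hy; linarith
    exact mul_le_mul' le_rfl (ofReal_norm_sq_zeroMode_le hvU hper hy0)
  have hA : A = 0 := coeff_eq_zero_of_lintegral_lt_top hs hAB hfin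
  refine ⟨B, fun y hy => ?_⟩
  rw [hAB y hy, hA, zero_mul, zero_add]

end ZeroTerm

end Literature.NumberTheory.Automorphic

end
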